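import Literature.NumberTheory.EllipticCurves.TakahashiDegreeFormulaProofs
import HarnessLib

/-!
# Takahashi 2001 Thm. 2.3 (`δ = h_r j_r / i_r`): split into multiplicity one and the
# character-group dictionary

Topic `Literature/NumberTheory/EllipticCurves`. The named fact `takahashi2001_thm_2_3`
(`TakahashiDegreeFormula.lean`; S. Takahashi, J. Number Theory 90 (2001), Thm. 2.3, case `D = 1`)
hit the literature-prover budget cap as ONE statement. Its printed algebra (Lemmas 2.1–2.2,
Thm. 2.3 over abstract character-group data) is PROVED in `TakahashiDegreeFormulaProofs`, whose
glue `takahashi2001_thm_2_3_of_brandtDictionary'` derives the fact from ONE package of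
hypotheses — the dictionary between `π : J₀(Mr) → E` at the prime `r` and the Brandt module of
the definite quaternion algebra of discriminant `r`, level `M`. That package has two independent
sources in print, which this file names separately:

1. `takahashi2001_brandtEigenLattice_rank_one` — **multiplicity one on the quaternion side**
   (Takahashi p. 78: "`L_r(J) = {x ∈ X_r(J) : T_n x = a_n(f) x for all n prime to N}` … is a
   free `ℤ`-module of rank one", by the Jacquet–Langlands correspondence / Eichler's basis
   problem and strong multiplicity one): for the modular elliptic curve `W` of squarefree
   conductor `M r` the common eigen-lattice of the Brandt matrices `T(p)`, `p ∤ M r`, for the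
   eigenvalues `a_p(W)` has `ℤ`-rank one. A statement about Brandt matrices and `a_p(W)` only.
2. `takahashi2001_characterGroupDictionary` — **the geometric dictionary** (Takahashi §2 p. 78
   and proof of Thm. 3.8 p. 84: `X_r(J₀(Mr)) ≅ ℤ[Cls O]⁰` compatibly with Hecke operators and
   monodromy pairings, Buzzard 1997 Thm. 4.7 / Ribet 1990 §3; Grothendieck's pairing SGA 7 IX
   11.5 with `u_E(x_r, x_r) = c_r = ord_r Δ_min(E)`; `π_* π^* = δ`; optimality of `π`; "the image
   of `π^*` lies in `L_r(J)`"): the maps `π^* : X_r(E) = ℤ → X`, `π_* : X → ℤ` on a saturated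
   sublattice `X ⊆ ℤ^{Cls O}` with these properties EXIST.

`takahashi2001_thm_2_3_holds_of` PROVES the parent from 1–2 (through
`takahashi2001_thm_2_3_of_brandtDictionary'`). Neither child restates the parent: 1 is a rank
statement on the quaternion side with no parametrisation degree in it, 2 asserts the existence of
the functorial character-group data with no multiplicity statement.

## References

* [Takahashi2001] S. Takahashi, Degrees of parametrizations of elliptic curves by Shimura curves,
  J. Number Theory 90 (2001) 74–88, §2 (p. 78), Lemma 2.1–2.2, Thm. 2.3 (p. 79), proof of
  Thm. 3.8 (p. 84).
* [Ribet1990] K. Ribet, Invent. Math. 100 (1990), §3.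
* [Buzzard1997] K. Buzzard, Duke Math. J. 87 (1997), Thm. 4.7.
* [PollackWeston2011] R. Pollack, T. Weston, Compositio Math. 147 (2011), §2.1, Prop. 6.5.
* [Kohel2001] D. Kohel, Hecke module structure of quaternions, Adv. Stud. Pure Math. 30 (2001)
  177–195, §3.1–3.2, Thm. 4.2–4.3 (the dictionary at arbitrary Eichler level; READ,
  doi:10.2969/aspm/03010177).
* [ConradStein2001] B. Conrad, W. A. Stein, Component groups of purely toric quotients, Math. Res.
  Lett. 8 (2001) 745–766, §2.1, §7.1 (READ, doi:10.4310/mrl.2001.v8.n6.a5).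
-/

noncomputable section

namespace Literature.NumberTheory.EllipticCurves

open scoped BigOperators
open Literature.NumberTheory.Automorphic Literature.NumberTheory.EllipticCurves.ModularForms

/-- **Multiplicity one for the Brandt eigen-lattice of a modular elliptic curve (Takahashi 2001,
§2 p. 78: "`L_r(J)` is a free `ℤ`-module of rank one"; Jacquet–Langlands / Eichler's basis
problem with strong multiplicity one).** For `W/ℚ` elliptic of squarefree conductor `M r`, `r`
prime, admitting a modular parametrisation datum at level `M r` (modularity), and every Brandt
setup `S` of type `(M, r)` (definite quaternion algebra of discriminant `r`, Eichler order of
level `M`): the lattice of `v ∈ ℤ^{Cls O}` with `T(p) v = a_p(W) v` for all primes `p ∤ M r`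
(`Brandt.eigenLattice`) has `ℤ`-rank one — the newform of `W` is new at `r`, so its Hecke
eigensystem occurs in the Brandt module exactly once.  Takahashi (p. 78) and Pollack–Weston
(§2.1) ASSERT this without proof; the proving source is Eichler's basis theorem in Hecke-module
form, Pizer 1980 (J. Algebra 64) Thm. 2.28 (`(ℂ^{Cls O})⁰ ⊕ 2 S₂(M) ≅ S₂(rM)` over the Hecke
algebra away from `rM`), combined with Atkin–Lehner multiplicity one: the tree PROVES this fact
from that isomorphism (taken as data, `BrandtJL.EichlerPizerIso`) in
`TakahashiDegreeFormulaFromDictionaryProofs`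
(`takahashi2001_brandtEigenLattice_rank_one_of_eichlerPizerIso`). [cite: Takahashi2001, §2 p. 78]
[cite: PollackWeston2011, §2.1] [cite: Pizer1980, Thm. 2.28 (case r = 0, k = 2)] -/
def takahashi2001_brandtEigenLattice_rank_one : Prop :=
  ∀ (W : WeierstrassCurve ℚ) [W.IsElliptic] (M r : ℕ) [NeZero (M * r)],
    r.Prime → Squarefree (M * r) → W.conductorNorm ℤ = M * r →
    ∀ (_P : ModularParametrizationData W (M * r)) (S : Brandt.XiSetup M r)
      [Fintype (Brandt.ClassSet S.O)],
      Module.finrank ℤ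
        (Brandt.eigenLattice (M * r) (Brandt.matrix S.O) (fun n => W.LFunction n)) = 1

/-- **The character-group dictionary at `r ∥ N` (Takahashi 2001 §2 p. 78 and proof of Thm. 3.8
p. 84; Ribet 1990 §3; Buzzard 1997 Thm. 4.7; Grothendieck SGA 7 IX 11.5).** For `W/ℚ` elliptic of
squarefree conductor `M r`, `r` prime, a parametrisation datum `P` at level `M r` of minimal
degree among all data with the same newform (so `P` is the optimal quotient `π : J₀(Mr) → E` and
`P.modularDegree = δ`), and every Brandt setup `S` of type `(M, r)`: there are a sublattice
`X ⊆ ℤ^{Cls O}` (the character group `X_r(J₀(Mr))`, identified with the degree-zero divisors on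
`Cls O` compatibly with `T_n`, `(n, N) = 1`, and with the monodromy pairing `⟨e_i, e_j⟩ = w_i δ_ij`)
and `ℤ`-linear maps `pb : ℤ → X` (`π^*` on `X_r(E) ≅ ℤ`, multiplicative reduction at `r`),
`pf : X → ℤ` (`π_*`) such that: `u_J(π^* a, y) = c_r · a · π_*(y)` with
`c_r = u_E(x_r, x_r) = #Φ_r(E) = ord_r Δ_min(W)` (adjunction for Grothendieck's pairing);
`π_* π^* = δ = P.modularDegree`; `π_*` is surjective (optimality); `X` is saturated in
`ℤ^{Cls O}`; and `π^* 1` lies in the `a(W)`-eigen-lattice of the Brandt matrices ("the image of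
`π^*` lies in `L_r(J)`"). This is the hypothesis package of
`takahashi2001_thm_2_3_of_brandtDictionary'` without its multiplicity-one conjunct. Printed letters
of the two geometric inputs at ARBITRARY cofactor `M` (refereed; read first-hand in the cells
`pub/bsd-litref/bstw24` — r2 TWIST-ADD-7, 8, r1 MOAKHER319-ADD-4 — and `pub/bsd-cited` r16 S6; referee
C4 ROUND C4-R3-ADD-12 (α)): the isometric, `T_n`-compatible (`(n, rM) = 1`) identification
`X(r, M) ≅ 𝒳(J₀(Mr), r)` of the Brandt module of an Eichler order of level `M` (inner product
`½|Isom(I, J)|` = `Brandt.weight` on the diagonal) with the character group is Kohel, Adv. Stud. Pure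
Math. 30 (2001), Thm. 4.3 at `D = 1` (§3.1–3.2; Thm. 4.2 "proved by Ribet for `D = 1`"); that
`J₀(Mr)` is semistable at `r ∥ N` with `r`-new part purely toric, and the optimal-quotient /
monodromy-pairing bookkeeping (`m_E = δ`, saturation `L` of `π^* X_E`, `Φ_X`, `m_X`), is Conrad–Stein,
Math. Res. Lett. 8 (2001), §2.1 and §7.1 (`N = Mp`, `M` arbitrary). The square-free hypothesis kept
here is Takahashi's standing one; the `r ∥ N` twin of the assembled fact is
`takahashi2001_thm_2_3_of_coprime` (`TakahashiDegreeFormula.lean`).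
[cite: Takahashi2001, §2 p. 78 and proof of Thm. 3.8 p. 84] [cite: Ribet1990, §3]
[cite: PollackWeston2011, Prop. 6.5] [cite: Kohel2001, Thm. 4.3 (D = 1), §3.1–3.2]
[cite: ConradStein2001, §2.1, §7.1] -/
def takahashi2001_characterGroupDictionary : Prop :=
  ∀ (W : WeierstrassCurve ℚ) [W.IsElliptic] (M r : ℕ) [NeZero (M * r)],
    r.Prime → Squarefree (M * r) → W.conductorNorm ℤ = M * r →
    ∀ P : ModularParametrizationData W (M * r),
      (∀ (W' : WeierstrassCurve ℚ) [W'.IsElliptic] (P' : ModularParametrizationData W' (M * r)),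
          P'.f = P.f → P.modularDegree ≤ P'.modularDegree) →
      ∀ (S : Brandt.XiSetup M r) [Fintype (Brandt.ClassSet S.O)],
        ∃ (X : Submodule ℤ (Brandt.ClassSet S.O → ℤ)) (pb : ℤ →ₗ[ℤ] X) (pf : X →ₗ[ℤ] ℤ),
          (∀ (a : ℤ) (y : X),
              ∑ i, (Brandt.weight S.O i : ℤ) * (pb a : Brandt.ClassSet S.O → ℤ) i *
                  (y : Brandt.ClassSet S.O → ℤ) i =
                ((W.minimalDiscriminantNorm ℤ).factorization r : ℤ) * a * pf y) ∧
          (∀ a : ℤ, pf (pb a) = (P.modularDegree : ℤ) * a) ∧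
          Function.Surjective pf ∧
          (∀ (m : ℤ) (v : Brandt.ClassSet S.O → ℤ), m ≠ 0 → m • v ∈ X → v ∈ X) ∧
          (pb 1 : Brandt.ClassSet S.O → ℤ) ∈
            Brandt.eigenLattice (M * r) (Brandt.matrix S.O) (fun n => W.LFunction n)

/-- **Assembly (Takahashi 2001 Thm. 2.3 from multiplicity one and the dictionary).** The two
named inputs give the hypothesis package of `takahashi2001_thm_2_3_of_brandtDictionary'`
(rank-one form), whence the fact. [cite: Takahashi2001, Thm. 2.3 (p. 79) and §2 p. 78] -/
theorem takahashi2001_thm_2_3_holds_of (h₁ : takahashi2001_brandtEigenLattice_rank_one)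
    (h₂ : takahashi2001_characterGroupDictionary) : takahashi2001_thm_2_3 := by
  refine takahashi2001_thm_2_3_of_brandtDictionary' ?_
  intro W _ M r _ hr hsq hN P hmin S _
  obtain ⟨X, pb, pf, hadj, hδ, hsurj, hXsat, hmem⟩ := h₂ W M r hr hsq hN P hmin S
  exact ⟨X, pb, pf, hadj, hδ, hsurj, hXsat, h₁ W M r hr hsq hN P S, hmem⟩

end Literature.NumberTheory.EllipticCurves

end
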